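import Summits.QuantumFields.YangMills.Theorems.FluctuationComparisonRegPrIntLS2BetaTreeGaugeChart
import Summits.QuantumFields.YangMills.Theorems.FluctuationComparisonRegPrIntLS2BetaSignedCombCount
import Literature.MathematicalPhysics.QuantumFieldTheory.Balaban1983to89.T3OrbitAverage
import Literature.MathematicalPhysics.QuantumFieldTheory.Balaban1983to89.FieldMeasureExpChartChangeOfVariables
import Literature.MathematicalPhysics.QuantumFieldTheory.Balaban1983to89.HaarExponentialChartMeasure
import HarnessLib

/-!
# Route `FluctuationComparisonRegPrIntL` (stmt-QuantumFields-20520), LINE g18-1 S2β LAPLACE — (C3β″) TUBULAR HAAR COORDINATES AROUND AN ORBIT OF THE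
# GROUP `K₀ × SU(2)^{pivots}` IN `SU(2)^{bonds}` (the chart-side hypotheses `hσ he he1 he𝓝 hΘ'𝓝 hWo hinj hJc hJ0 hchart` of
# `Literature.Analysis.Asymptotics.LaplaceMethodOrbitCompact`, in the pivot-blind action of record, px11 g9's `pivotAct`)

Cell `ym3-torus` (HUMAN RULING D-0037 — YM₃ on T³ is ladder rung R3, not the Clay problem), width seat `ym3-torus-px21` g9; count-neutral helper
(`--kind proof --supports stmt-QuantumFields-20520 --as helper`).

THE PROOF = ONE APPLICATION OF THE GENERIC TREE-GAUGE CHART `…S2BetaTreeGaugeChart.exists_tubularChart_of_treeGauge` (p736010) to the lattice with ONE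
VIRTUAL SITE PER PIVOT.  Sites `I = Site P 0 ⊕ PBond P k`; a non-pivot bond `b` runs from `inl b₋` to `inl b₊`, the pivot `βₖ(c)` runs from the virtual site
`inr c` to the root `inl (root βₖ(c)₊)`; roots `R = inl(k-centres)`; killed set `F = combSet k ∪ pivots`; tree gauge
`g V = Sum.elim (combTransporter k V) (c ↦ V(βₖ c)⁻¹)`.  Then the generic «gauge action» `a • V (b) = a(s b) V(b) a(t b)⁻¹` of a root-trivial `a : I → SU(2)` IS
the action of record: the gauge formula with `a ∘ inl` off the pivots and the LEFT translation by `a (inr c)` on the pivot `βₖ(c)` (`a(root) = 1`);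
the six tree-gauge axioms are the signed-comb facts of (C3-c) I–III (`combTransporter_one ∕ _embIter ∕ _gaugeAct_of_rootTrivial ∕ _kill ∕ _congr`,
`iterCentralBond_not_mem_combSet`) plus one-line computations at the virtual sites; the dimension bookkeeping is `nat_card_combSet`
(`#comb = #T_η − #T⁽ᵏ⁾`).  No product of charts, no splitting of the Euclidean model is needed.
HONEST: a chart-side helper; nothing of LIMIT∕LAPLACE∕S2β∕crux 20520 is proved here; rung R3 — NOT d = 4, NOT infinite volume, NOT a mass gap, NOT Clay.
-/

noncomputable section

open MeasureTheory MeasureTheory.Measure Filter Topology Set Function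
open scoped ENNReal Matrix.Norms.L2Operator
open Literature.MathematicalPhysics.QuantumFieldTheory.Balaban1983to89
open Literature.MathematicalPhysics.QuantumFieldTheory.Balaban1983to89.B12GaugeOrbits021 (IsResidual)
open Literature.MathematicalPhysics.QuantumFieldTheory.Balaban1983to89.HaarExponentialChart
open Literature.MathematicalPhysics.QuantumFieldTheory.Balaban1983to89.LogChartProduct
open Literature.MathematicalPhysics.QuantumFieldTheory.Balaban1983to89.T4RootedResidualGauge (rootOf rootOf_embIter)
open Literature.MathematicalPhysics.QuantumFieldTheory.Balaban1983to89.B15DeterminingSets (embIter)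
open Literature.MathematicalPhysics.QuantumFieldTheory.Balaban1983to89.B14.Eq22Determines (blockIter)
open Literature.MathematicalPhysics.QuantumFieldTheory.Balaban1983to89.B15Eq177GaugeInvariance (blockIter_embIter)
open scoped Literature.MathematicalPhysics.QuantumFieldTheory.Balaban1983to89.T3OrbitAverage
open Summit.QuantumFields.YangMills.Theorems.FluctuationComparisonRegPrIntLWregChain (iterCentralBond iterCentralBond_injective)
open Summit.QuantumFields.YangMills.Theorems.FluctuationComparisonRegPrIntLS2BetaTreeGaugeChart
open Summit.QuantumFields.YangMills.Theorems.FluctuationComparisonRegPrIntLS2BetaSignedComb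
open Summit.QuantumFields.YangMills.Theorems.FluctuationComparisonRegPrIntLS2BetaSignedCombKill
open Summit.QuantumFields.YangMills.Theorems.FluctuationComparisonRegPrIntLS2BetaSignedCombCount

namespace Summit.QuantumFields.YangMills.Theorems.FluctuationComparisonRegPrIntLS2BetaTubularChartAct

/-- ★★★ **(C3β″) TUBULAR HAAR COORDINATES AROUND AN ORBIT OF `K₀ × SU(2)^{pivots}`** (letter v2.1 of the bus, now PROVED).  Setting of w5-20520 g13's
(β″): the fine fields `X = SU(2)^{bonds}` with product Haar `dU`; the group `Kg = K₀ × SU(2)^{PBond (F.P K) k}` (`K₀` = level-`k` residual = root-trivial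
transformations, `k := K − J`) acting by `ACT (w, hp) U := extend (iterCentralBond k) (c ↦ hp c · U (iterCentralBond k c)) (w • U)` (gauge formula OFF the
pivots, LEFT translation ON the pivots — px11 g9's `pivotAct`, a left action of the direct product).  For every base point `U₀` there are Euclidean models of the DATUM-INDEPENDENT dimensions
`dZ = dim 𝔰𝔲(2)·((#T − #T⁽ᵏ⁾) + #pivots)`, `dV = dim 𝔰𝔲(2)·(#bonds − #pivots) − dim 𝔰𝔲(2)·(#T − #T⁽ᵏ⁾)`, a group chart `e = (e_res, e_piv)`, a continuous
transversal `σ` through `U₀` (transversal to BOTH factors), an open window `W ∋ 0` with a ball `closedBall 0 ρ ×ˢ {0} ⊆ W`, on which the tube map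
`Θ'(z, y) = ACT (e z) (σ y)` is injective and open at the origin, and a continuous density `J ≥ 0`, `J(0,0) > 0`, with `dU|_{Θ'(W)} = Θ'_*((J · dz ⊗ dy)|_W)`.
Proof: `…S2BetaTreeGaugeChart.exists_tubularChart_of_treeGauge` on the lattice with one virtual site per pivot (module docstring). [cite: Helgason2000, Ch. I §1 Thm 1.14 (13) p. 96; Balaban1985Averaging, (8), (10) p.18; Balaban1985Variational, Thm 1 (8)-(10) p.279] -/
theorem exists_tubularHaarChart_act (P : Params) {k : ℕ} (hk : k ≤ P.m + P.K) (dZ dV : ℕ)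
    (hdZ : dZ = Module.finrank ℝ (specialUnitaryLogChart (Fin 2)).lie *
      ((Fintype.card (Site P 0) - Fintype.card (Site P k)) + Fintype.card (PBond P k)))
    (hdV : dV = Module.finrank ℝ (specialUnitaryLogChart (Fin 2)).lie * (Fintype.card (PBond P 0) - Fintype.card (PBond P k)) -
      Module.finrank ℝ (specialUnitaryLogChart (Fin 2)).lie * (Fintype.card (Site P 0) - Fintype.card (Site P k)))
    (U₀ : GaugeField P 0 (Matrix.specialUnitaryGroup (Fin 2) ℂ)) :
    ∃ (e : EuclideanSpace ℝ (Fin dZ) →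
          (Site P 0 → Matrix.specialUnitaryGroup (Fin 2) ℂ) × (PBond P k → Matrix.specialUnitaryGroup (Fin 2) ℂ))
      (σ : EuclideanSpace ℝ (Fin dV) → GaugeField P 0 (Matrix.specialUnitaryGroup (Fin 2) ℂ))
      (W : Set (EuclideanSpace ℝ (Fin dZ) × EuclideanSpace ℝ (Fin dV)))
      (J : EuclideanSpace ℝ (Fin dZ) × EuclideanSpace ℝ (Fin dV) → ℝ) (ρ₀ : ℝ),
      Continuous e ∧ e 0 = 1 ∧ (∀ z, IsResidual k (e z).1) ∧
      (∀ s ∈ 𝓝 (0 : EuclideanSpace ℝ (Fin dZ)),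
        ∃ t ∈ 𝓝 ((1 : Site P 0 → Matrix.specialUnitaryGroup (Fin 2) ℂ), (1 : PBond P k → Matrix.specialUnitaryGroup (Fin 2) ℂ)),
          ∀ w ∈ t, IsResidual k w.1 → w ∈ e '' s) ∧
      Continuous σ ∧ σ 0 = U₀ ∧
      IsOpen W ∧ 0 < ρ₀ ∧ Metric.closedBall (0 : EuclideanSpace ℝ (Fin dZ)) ρ₀ ×ˢ {(0 : EuclideanSpace ℝ (Fin dV))} ⊆ W ∧
      InjOn (fun p : EuclideanSpace ℝ (Fin dZ) × EuclideanSpace ℝ (Fin dV) =>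
          Function.extend (iterCentralBond (P := P) k) (fun c => (e p.1).2 c * σ p.2 (iterCentralBond (P := P) k c))
            (GaugeField.gaugeAct (e p.1).1 (σ p.2))) W ∧
      (∀ s ∈ 𝓝 ((0 : EuclideanSpace ℝ (Fin dZ)), (0 : EuclideanSpace ℝ (Fin dV))),
          (fun p : EuclideanSpace ℝ (Fin dZ) × EuclideanSpace ℝ (Fin dV) =>
            Function.extend (iterCentralBond (P := P) k) (fun c => (e p.1).2 c * σ p.2 (iterCentralBond (P := P) k c))
              (GaugeField.gaugeAct (e p.1).1 (σ p.2))) '' s ∈ 𝓝 U₀) ∧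
      ContinuousOn J W ∧ (∀ w ∈ W, 0 ≤ J w) ∧ 0 < J (0, 0) ∧
      (fieldMeasure P 0 (Matrix.specialUnitaryGroup (Fin 2) ℂ)).restrict
          ((fun p : EuclideanSpace ℝ (Fin dZ) × EuclideanSpace ℝ (Fin dV) =>
            Function.extend (iterCentralBond (P := P) k) (fun c => (e p.1).2 c * σ p.2 (iterCentralBond (P := P) k c))
              (GaugeField.gaugeAct (e p.1).1 (σ p.2))) '' W) =
        ((((volume : Measure (EuclideanSpace ℝ (Fin dZ))).prod (volume : Measure (EuclideanSpace ℝ (Fin dV)))).restrict W).withDensity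
            (fun w => ENNReal.ofReal (J w))).map
          (fun p : EuclideanSpace ℝ (Fin dZ) × EuclideanSpace ℝ (Fin dV) =>
            Function.extend (iterCentralBond (P := P) k) (fun c => (e p.1).2 c * σ p.2 (iterCentralBond (P := P) k c))
              (GaugeField.gaugeAct (e p.1).1 (σ p.2))) := by
  classical
  -- the group, its chart and its Haar probability measure
  haveI : FiniteDimensional ℝ (Matrix (Fin 2) (Fin 2) ℂ) := FiniteDimensional.complexToReal _
  haveI : (HaarData.haar : Measure (Matrix.specialUnitaryGroup (Fin 2) ℂ)).IsHaarMeasure :=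
    FieldMeasureExpChartChangeOfVariables.isHaarMeasure_haar_specialUnitaryGroup (N := 2)
  have hch := isChartRep_specialUnitaryGroup (n := Fin 2)
  have hlie := lie_adStable_specialUnitaryGroup (n := Fin 2)
  -- the pivots
  have hιinj : Injective (iterCentralBond (P := P) k) := iterCentralBond_injective hk
  have hembinj : Injective (embIter k : Site P k → Site P 0) := Function.LeftInverse.injective (blockIter_embIter k hk)
  -- the extended lattice: one virtual site `inr c` per pivot
  set s' : PBond P 0 → Site P 0 ⊕ PBond P k :=
    Function.extend (iterCentralBond (P := P) k) (fun c => Sum.inr c) (fun b => Sum.inl b.src) with hs'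
  set t' : PBond P 0 → Site P 0 ⊕ PBond P k :=
    Function.extend (iterCentralBond (P := P) k) (fun c => Sum.inl (rootOf k (iterCentralBond (P := P) k c).tgt))
      (fun b => Sum.inl b.tgt) with ht'
  set R' : Set (Site P 0 ⊕ PBond P k) := Set.range (fun y : Site P k => (Sum.inl (embIter k y) : Site P 0 ⊕ PBond P k)) with hR'
  set F' : Set (PBond P 0) := (combSet k : Set (PBond P 0)) ∪ Set.range (iterCentralBond (P := P) k) with hF'
  set g' : (PBond P 0 → Matrix.specialUnitaryGroup (Fin 2) ℂ) → (Site P 0 ⊕ PBond P k → Matrix.specialUnitaryGroup (Fin 2) ℂ) :=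
    fun V => Sum.elim (fun x => combTransporter k V x) (fun c => (V (iterCentralBond (P := P) k c))⁻¹) with hg'
  have hs'piv : ∀ c, s' (iterCentralBond (P := P) k c) = Sum.inr c := fun c => hιinj.extend_apply _ _ c
  have ht'piv : ∀ c, t' (iterCentralBond (P := P) k c) = Sum.inl (rootOf k (iterCentralBond (P := P) k c).tgt) :=
    fun c => hιinj.extend_apply _ _ c
  have hs'off : ∀ b, b ∉ Set.range (iterCentralBond (P := P) k) → s' b = Sum.inl b.src :=
    fun b hb => Function.extend_apply' _ _ b hb
  have ht'off : ∀ b, b ∉ Set.range (iterCentralBond (P := P) k) → t' b = Sum.inl b.tgt :=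
    fun b hb => Function.extend_apply' _ _ b hb
  have hrootR : ∀ x : Site P 0, (Sum.inl (rootOf k x) : Site P 0 ⊕ PBond P k) ∈ R' := fun x => ⟨blockIter k x, rfl⟩
  have hcombOff : ∀ b ∈ (combSet k : Set (PBond P 0)), b ∉ Set.range (iterCentralBond (P := P) k) :=
    fun b hb ⟨c, hc⟩ => iterCentralBond_not_mem_combSet hk c (hc ▸ hb)
  -- Borel structures and frames
  letI : MeasurableSpace (piLogChart (specialUnitaryLogChart (Fin 2)) {x : Site P 0 ⊕ PBond P k // x ∉ R'}).lie := borel _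
  haveI : BorelSpace (piLogChart (specialUnitaryLogChart (Fin 2)) {x : Site P 0 ⊕ PBond P k // x ∉ R'}).lie := ⟨rfl⟩
  letI : MeasurableSpace (piLogChart (specialUnitaryLogChart (Fin 2)) {b : PBond P 0 // b ∉ F'}).lie := borel _
  haveI : BorelSpace (piLogChart (specialUnitaryLogChart (Fin 2)) {b : PBond P 0 // b ∉ F'}).lie := ⟨rfl⟩
  haveI := finiteDimensional_piLogChart_lie (specialUnitaryLogChart (Fin 2)) {x : Site P 0 ⊕ PBond P k // x ∉ R'}
  haveI := finiteDimensional_piLogChart_lie (specialUnitaryLogChart (Fin 2)) {b : PBond P 0 // b ∉ F'}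
  have hfr : ∀ (B : Type) [Fintype B], Module.finrank ℝ (piLogChart (specialUnitaryLogChart (Fin 2)) B).lie =
      Fintype.card B * Module.finrank ℝ (specialUnitaryLogChart (Fin 2)).lie := by
    intro B _
    rw [LinearEquiv.finrank_eq (lieEquivPi (specialUnitaryLogChart (Fin 2)) B), Module.finrank_pi_fintype, Finset.sum_const,
      Finset.card_univ, smul_eq_mul]
  -- cardinalities
  have hcardR : Fintype.card {x : Site P 0 ⊕ PBond P k // x ∉ R'} =
      (Fintype.card (Site P 0) - Fintype.card (Site P k)) + Fintype.card (PBond P k) := by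
    have hinj : Injective (fun y : Site P k => (Sum.inl (embIter k y) : Site P 0 ⊕ PBond P k)) :=
      Sum.inl_injective.comp hembinj
    have h1 : Nat.card {x : Site P 0 ⊕ PBond P k // x ∉ R'} = Nat.card (Site P 0 ⊕ PBond P k) - R'.ncard := by
      rw [← Set.ncard_compl R', ← Nat.card_coe_set_eq]; rfl
    have h2 : R'.ncard = Fintype.card (Site P k) := by
      rw [← Nat.card_coe_set_eq, hR', Nat.card_range_of_injective hinj, Nat.card_eq_fintype_card]
    have hle : Fintype.card (Site P k) ≤ Fintype.card (Site P 0) := Fintype.card_le_of_injective _ hembinj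
    rw [← Nat.card_eq_fintype_card, h1, h2, Nat.card_sum, Nat.card_eq_fintype_card, Nat.card_eq_fintype_card]
    omega
  have hcardF : Fintype.card {b : PBond P 0 // b ∉ F'} =
      (Fintype.card (PBond P 0) - Fintype.card (PBond P k)) - (Fintype.card (Site P 0) - Fintype.card (Site P k)) := by
    have h1 : Nat.card {b : PBond P 0 // b ∉ F'} = Nat.card (PBond P 0) - F'.ncard := by
      rw [← Set.ncard_compl F', ← Nat.card_coe_set_eq]; rfl
    have h2 : F'.ncard = (Fintype.card (Site P 0) - Fintype.card (Site P k)) + Fintype.card (PBond P k) := by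
      rw [hF', Set.ncard_union_eq (Set.disjoint_left.2 fun b hb hb' => hcombOff b hb hb'), ← Nat.card_coe_set_eq,
        nat_card_combSet hk, ← Nat.card_coe_set_eq, Nat.card_range_of_injective hιinj, Nat.card_eq_fintype_card]
    rw [← Nat.card_eq_fintype_card, h1, h2, Nat.card_eq_fintype_card]
    omega
  obtain ⟨eZ⟩ : Nonempty (EuclideanSpace ℝ (Fin dZ) ≃L[ℝ]
      (piLogChart (specialUnitaryLogChart (Fin 2)) {x : Site P 0 ⊕ PBond P k // x ∉ R'}).lie) :=
    ⟨ContinuousLinearEquiv.ofFinrankEq (by rw [finrank_euclideanSpace_fin, hfr, hcardR, hdZ, mul_comm])⟩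
  obtain ⟨eV⟩ : Nonempty (EuclideanSpace ℝ (Fin dV) ≃L[ℝ] (piLogChart (specialUnitaryLogChart (Fin 2)) {b : PBond P 0 // b ∉ F'}).lie) :=
    ⟨ContinuousLinearEquiv.ofFinrankEq (by
      rw [finrank_euclideanSpace_fin, hfr, hcardF, hdV, Nat.sub_mul, mul_comm (Fintype.card (PBond P 0) - _),
        mul_comm (Fintype.card (Site P 0) - _)])⟩
  -- the six tree-gauge axioms
  have hgc : Continuous g' := by
    refine continuous_pi fun i => ?_
    rcases i with x | c
    · exact (continuous_apply x).comp (continuous_combTransporter (P := P) (G := Matrix.specialUnitaryGroup (Fin 2) ℂ) k)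
    · exact (continuous_apply (iterCentralBond (P := P) k c)).inv
  have hgR : ∀ V, ∀ r ∈ R', g' V r = 1 := by
    rintro V r ⟨y, rfl⟩
    exact combTransporter_embIter hk V y
  have hcov : ∀ (a : Site P 0 ⊕ PBond P k → Matrix.specialUnitaryGroup (Fin 2) ℂ), (∀ r ∈ R', a r = 1) →
      ∀ (V : PBond P 0 → Matrix.specialUnitaryGroup (Fin 2) ℂ) (x : Site P 0 ⊕ PBond P k),
        g' (fun b => a (s' b) * V b * (a (t' b))⁻¹) x = g' V x * (a x)⁻¹ := by
    intro a ha V x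
    have hroot : ∀ y : Site P k, a (Sum.inl (embIter k y)) = 1 := fun y => ha _ ⟨y, rfl⟩
    rcases x with x | c
    · show combTransporter k (fun b => a (s' b) * V b * (a (t' b))⁻¹) x = combTransporter k V x * (a (Sum.inl x))⁻¹
      have hE : ∀ b ∈ (combSet k : Set (PBond P 0)), (fun b => a (s' b) * V b * (a (t' b))⁻¹) b =
          GaugeField.gaugeAct (fun y => a (Sum.inl y)) V b := by
        intro b hb
        simp only [GaugeField.gaugeAct, hs'off b (hcombOff b hb), ht'off b (hcombOff b hb)]
      rw [congrFun (combTransporter_congr hk hE) x, combTransporter_gaugeAct_of_rootTrivial k hroot V x]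
    · show (a (s' (iterCentralBond (P := P) k c)) * V (iterCentralBond (P := P) k c) * (a (t' (iterCentralBond (P := P) k c)))⁻¹)⁻¹ =
        (V (iterCentralBond (P := P) k c))⁻¹ * (a (Sum.inr c))⁻¹
      rw [hs'piv, ht'piv, ha _ (hrootR _), inv_one, mul_one, mul_inv_rev]
  have hkill : ∀ V, ∀ b ∈ F', g' V (s' b) * V b * (g' V (t' b))⁻¹ = 1 := by
    intro V b hb
    rcases hb with hb | ⟨c, rfl⟩
    · rw [hs'off b (hcombOff b hb), ht'off b (hcombOff b hb)]
      exact combTransporter_kill hk V hb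
    · rw [hs'piv, ht'piv]
      show (V (iterCentralBond (P := P) k c))⁻¹ * V (iterCentralBond (P := P) k c) *
        (combTransporter k V (rootOf k (iterCentralBond (P := P) k c).tgt))⁻¹ = 1
      rw [inv_mul_cancel, one_mul, show rootOf k (iterCentralBond (P := P) k c).tgt =
        embIter k (blockIter k (iterCentralBond (P := P) k c).tgt) from rfl, combTransporter_embIter hk, inv_one]
  have hloc : ∀ V V' : PBond P 0 → Matrix.specialUnitaryGroup (Fin 2) ℂ, (∀ b ∈ F', V b = V' b) → g' V = g' V' := by
    intro V V' hVV
    funext i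
    rcases i with x | c
    · exact congrFun (combTransporter_congr hk fun b hb => hVV b (Or.inl hb)) x
    · show (V (iterCentralBond (P := P) k c))⁻¹ = (V' (iterCentralBond (P := P) k c))⁻¹
      rw [hVV _ (Or.inr ⟨c, rfl⟩)]
  have hg1 : g' (fun _ => 1) = fun _ => 1 := by
    funext i
    rcases i with x | c
    · show combTransporter k (1 : GaugeField P 0 (Matrix.specialUnitaryGroup (Fin 2) ℂ)) x = 1
      rw [combTransporter_one]
    · exact inv_one
  -- THE GENERIC CHART
  obtain ⟨e, σ, W, J, hec, he0, heR, hsurj, hσc, hσ0, hWo, hW0, hinj, hopen, hJc, hJ0, hJpos, hchart⟩ :=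
    exists_tubularChart_of_treeGauge hch hlie (HaarData.haar : Measure (Matrix.specialUnitaryGroup (Fin 2) ℂ)) s' t' R' F' g'
      eZ eV hgc hgR hcov hkill hloc hg1 U₀
  -- the action of record IS the generic gauge formula on the extended lattice
  have hkey : ∀ p : EuclideanSpace ℝ (Fin dZ) × EuclideanSpace ℝ (Fin dV),
      Function.extend (iterCentralBond (P := P) k) (fun c => e p.1 (Sum.inr c) * σ p.2 (iterCentralBond (P := P) k c))
        (GaugeField.gaugeAct (fun x => e p.1 (Sum.inl x)) (σ p.2)) = fun b => e p.1 (s' b) * σ p.2 b * (e p.1 (t' b))⁻¹ := by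
    intro p
    funext b
    by_cases hb : ∃ c, iterCentralBond (P := P) k c = b
    · obtain ⟨c, rfl⟩ := hb
      rw [hιinj.extend_apply, hs'piv, ht'piv, heR _ _ (hrootR _), inv_one, mul_one]
    · rw [Function.extend_apply' _ _ b hb, hs'off b hb, ht'off b hb]
      rfl
  have hΘ : (fun p : EuclideanSpace ℝ (Fin dZ) × EuclideanSpace ℝ (Fin dV) =>
      Function.extend (iterCentralBond (P := P) k)
        (fun c => ((fun x : Site P 0 => e p.1 (Sum.inl x)), (fun c : PBond P k => e p.1 (Sum.inr c))).2 c *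
          σ p.2 (iterCentralBond (P := P) k c))
        (GaugeField.gaugeAct ((fun x : Site P 0 => e p.1 (Sum.inl x)), (fun c : PBond P k => e p.1 (Sum.inr c))).1 (σ p.2))) =
      fun p => fun b => e p.1 (s' b) * σ p.2 b * (e p.1 (t' b))⁻¹ := by
    funext p; exact hkey p
  -- a ball in the window
  obtain ⟨ε, hε, hball⟩ := Metric.isOpen_iff.1 hWo _ hW0
  refine ⟨fun z => ((fun x : Site P 0 => e z (Sum.inl x)), (fun c : PBond P k => e z (Sum.inr c))), σ, W, J, ε / 2,
    ?_, ?_, ?_, ?_, hσc, hσ0, hWo, by linarith, ?_, ?_, ?_, hJc, hJ0, hJpos, ?_⟩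
  · -- `e` continuous
    exact (continuous_pi fun x => (continuous_apply _).comp hec).prodMk (continuous_pi fun c => (continuous_apply _).comp hec)
  · -- `e 0 = 1`
    simp only [he0, Pi.one_apply]; rfl
  · -- residual
    intro z y
    exact heR z _ ⟨y, rfl⟩
  · -- onto a neighbourhood of `(1, 1)` among the residual pairs
    intro sZ hsZ
    obtain ⟨tt, htt, hsub⟩ := hsurj sZ hsZ
    set jn : (Site P 0 → Matrix.specialUnitaryGroup (Fin 2) ℂ) × (PBond P k → Matrix.specialUnitaryGroup (Fin 2) ℂ) →
        (Site P 0 ⊕ PBond P k → Matrix.specialUnitaryGroup (Fin 2) ℂ) := fun w => Sum.elim w.1 w.2 with hjn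
    have hjnc : Continuous jn := by
      refine continuous_pi fun i => ?_
      rcases i with x | c
      · exact (continuous_apply x).comp continuous_fst
      · exact (continuous_apply c).comp continuous_snd
    have hjn1 : jn ((1 : Site P 0 → Matrix.specialUnitaryGroup (Fin 2) ℂ), (1 : PBond P k → Matrix.specialUnitaryGroup (Fin 2) ℂ)) = 1 := by
      funext i; rcases i with x | c <;> rfl
    refine ⟨jn ⁻¹' tt, hjnc.continuousAt.preimage_mem_nhds (by rw [hjn1]; exact htt), ?_⟩
    intro w hw hwres
    have hR : ∀ r ∈ R', jn w r = 1 := by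
      rintro r ⟨y, rfl⟩
      exact hwres y
    obtain ⟨z, hz, hzw⟩ := hsub (jn w) hw hR
    refine ⟨z, hz, ?_⟩
    refine Prod.ext (funext fun x => ?_) (funext fun c => ?_)
    · exact congrFun hzw (Sum.inl x)
    · exact congrFun hzw (Sum.inr c)
  · -- the ball `closedBall 0 (ε/2) × {0}` lies in `W`
    intro p hp
    rw [Set.mem_prod, Metric.mem_closedBall, dist_zero_right, Set.mem_singleton_iff] at hp
    apply hball
    rw [Metric.mem_ball, Prod.dist_eq, hp.2, dist_self, dist_zero_right]
    exact max_lt (by linarith [hp.1]) hε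
  · -- injectivity on the window
    rw [hΘ]; exact hinj
  · -- openness at the origin
    rw [hΘ]; exact hopen
  · -- THE CHART IDENTITY (`fieldMeasure = ⊗ Haar` is `rfl`)
    rw [hΘ]; exact hchart

end Summit.QuantumFields.YangMills.Theorems.FluctuationComparisonRegPrIntLS2BetaTubularChartAct

end
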